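import Literature.Combinatorics.Sahi2008.TotalOrder
import Literature.Combinatorics.Sahi2008.Multilinear
import Literature.Combinatorics.Sahi2008.PushForward
import HarnessLib

/-!
# Lieb–Sahi (2022), §2.1 and §3.4: the discrete unit square — monotone subsets of the `m × m` grid,
# the perturbations `a⁺, a⁻, a⋆`, and the averaging identity (Propositions 2.6 / 3.10)

CITATION HEADER.  Source: E. H. Lieb, S. Sahi, *On the extension of the FKG inequality to `n` functions*,
J. Math. Phys. **63** (2022) 043301 = arXiv:2107.09838 [LiebSahi2021], §2 (Lemma 2.3: "Divide `Q_2`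
uniformly into `m²` little squares, write `D_{i,j}` for the square with top right vertex `(i/m, j/m)`,
and set `S_a = ⋃_{j ≤ a_i} D_{i,j}` … `𝒜(m) := {a ∈ ℤ^m | m ≥ a_1 ≥ ⋯ ≥ a_m ≥ 0}` … Then `S_a` is a
monotone subset of `Q_2`, and conversely any monotone union of `D_{i,j}` is of this form"), §2.1 ("we
work directly with `a, b, c`, and we define … `E_1(a) = E(a) = (a_1 + ⋯ + a_m)/m²` … We say that
`a ∈ 𝒜` has descent at `i` if `a_i > a_{i+1}`, and in this case we can define three new sequences
`a⁻ = a^{−,i}`, `a⁺ = a^{+,i}`, `a⋆ = a^{⋆,i}`, also in `𝒜`, in which the following changes, and only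
these, are made to `a`: `a⁻_i = a_{i+1}`, `a⁺_{i+1} = a_i`, `a⋆_{i+1} = a_{i+1} + 1`"; Lemma 2.5,
Prop. 2.6, Lemma 2.7) and §3.4 (Prop. 3.10: "If `a` has descent at `i`, but `a^1,…,a^{n−1}` do not,
then we have `2E_n(a^1,…,a^{n−1},a) = E_n(a^1,…,a^{n−1},a⁺) + E_n(a^1,…,a^{n−1},a⁻)`"); read
2026-08-19 from the materialised arXiv text (`lit read arxiv:2107.09838`).

This file sets up the DISCRETE model exactly as in §2.1 (0-indexed: the grid `Fin m × Fin m` with the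
uniform weight `1/m²`, `S_a = {(i,j) : j < a_i}` for an antitone `a : Fin m → Fin (m+1)`) on the tree's
`sahiE` (`Functional.lean`), and proves the averaging identity of Prop. 3.10 for every `n`.  The main
theorem (Thm. 3.13 = Thm. 3.7 in discrete form: `E_n ≥ 0` for all `n`) is `UnitSquareTheorem.lean`.

## Contents (everything PROVED; no named fact)

* `DSeq m` (Lieb–Sahi's `𝒜(m)`), `chi a` (`χ_a = χ_{S_a}`), `cells a` (`S_a`), the uniform weight
  `gridWeight m`; `chi_antitone` (`S_a` is a monotone = decreasing set).
* descent and the perturbations `plus`/`minus`/`star` with the pointwise identities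
  `χ_{a⁺} − χ_a = h`, `χ_a − χ_{a⁻} = h ∘ τ` (`τ` = swap of the columns `i, i+1`), `χ_{a⋆} = χ_a + 1_{cell}`
  (Lemmas 2.5, 2.7 in indicator form).
* `sahiE_comp_colSwap` — `E_n` under the uniform weight is invariant under the column swap (the weight is
  constant; `PushForward.sahiE_pushWeight`).
* **`sahiE_plus_add_minus`** — Prop. 3.10 (and 2.6): if slot `k` has descent at `i` and no other slot does,
  `E_n(…,a⁺,…) + E_n(…,a⁻,…) = 2E_n(…,a,…)`; proved by multilinearity and the reflection `τ`, which fixes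
  every other slot and exchanges the two differences.
-/

noncomputable section

namespace Literature.Combinatorics.Sahi2008

namespace UnitSquare

open Finset Function

variable {m : ℕ}

/-! ### The grid, the uniform weight, and Lieb–Sahi's monotone sets `S_a` -/

/-- The `m × m` grid `{D_{i,j}}` (0-indexed), with the product partial order. [cite: LiebSahi2021, §2 (Lemma 2.3)] -/
abbrev Grid (m : ℕ) := Fin m × Fin m

/-- The uniform weight `1/m²` on the grid (Lebesgue measure of a little square).
[cite: LiebSahi2021, §2.1 (`E_1(a) = (a_1+⋯+a_m)/m²`)] -/
def gridWeight (m : ℕ) : Grid m → ℝ := fun _ => 1 / ((m : ℝ) ^ 2)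

/-- The uniform weight is nonnegative. [cite: LiebSahi2021, §2.1] -/
theorem gridWeight_nonneg (m : ℕ) (x : Grid m) : 0 ≤ gridWeight m x := by
  unfold gridWeight
  positivity

/-- The uniform weight has total mass `1` (`m ≥ 1`). [cite: LiebSahi2021, §2.1] -/
theorem sum_gridWeight {m : ℕ} (hm : 0 < m) : ∑ x, gridWeight m x = 1 := by
  simp only [gridWeight, sum_const, card_univ, Fintype.card_prod, Fintype.card_fin, nsmul_eq_mul]
  have : (m : ℝ) ≠ 0 := by exact_mod_cast hm.ne'
  push_cast
  field_simp

/-- Lieb–Sahi's `𝒜(m)`: antitone sequences `a : Fin m → {0,…,m}` ("`m ≥ a_1 ≥ ⋯ ≥ a_m ≥ 0`"),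
indexing the monotone unions of little squares. [cite: LiebSahi2021, §2 (Lemma 2.3, the set 𝒜(m))] -/
def DSeq (m : ℕ) : Type := {a : Fin m → Fin (m + 1) // Antitone a}

/-- `𝒜(m)` is finite. [cite: LiebSahi2021, §2 (Lemma 2.3, the set 𝒜(m))] -/
instance : Fintype (DSeq m) := by
  classical
  unfold DSeq
  infer_instance

/-- `𝒜(m)` has decidable equality. [cite: LiebSahi2021, §2 (Lemma 2.3, the set 𝒜(m))] -/
instance : DecidableEq (DSeq m) := by
  classical
  unfold DSeq
  infer_instance

/-- The constant sequence `a ≡ 0` (so `𝒜(m)` is nonempty). [cite: LiebSahi2021, §2.1] -/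
instance : Inhabited (DSeq m) := ⟨⟨fun _ => 0, fun _ _ _ => le_rfl⟩⟩

/-- `χ_a = χ_{S_a}`, `S_a = {(i,j) : j < a_i}` (0-indexed form of `⋃_{j ≤ a_i} D_{i,j}`).
[cite: LiebSahi2021, §2 (Lemma 2.3, `S_a`, `χ_a = χ_{S_a}`)] -/
def chi (a : DSeq m) : Grid m → ℝ := fun p => if (p.2 : ℕ) < (a.1 p.1 : ℕ) then 1 else 0

/-- The set `S_a` of cells. [cite: LiebSahi2021, §2 (Lemma 2.3, `S_a`)] -/
def cells (a : DSeq m) : Finset (Grid m) := univ.filter fun p => (p.2 : ℕ) < (a.1 p.1 : ℕ)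

/-- `χ_a` is the indicator of `S_a`. [cite: LiebSahi2021, §2 (Lemma 2.3)] -/
theorem chi_eq_setInd (a : DSeq m) : chi a = setInd (cells a) := by
  funext p
  simp only [chi, setInd_apply, cells, mem_filter, mem_univ, true_and]

/-- `χ_a ≥ 0`. [cite: LiebSahi2021, §2 (before Lemma 2.2: positive functions)] -/
theorem chi_nonneg (a : DSeq m) (p : Grid m) : 0 ≤ chi a p := by
  unfold chi
  split_ifs <;> norm_num

/-- `S_a` is a monotone (= decreasing, [LiebSahi2021, §2]) subset: `χ_a` is antitone for the product
order. [cite: LiebSahi2021, §2 (Lemma 2.3: "`S_a` is a monotone subset of `Q_2`")] -/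
theorem chi_antitone (a : DSeq m) : Antitone (chi a) := by
  intro p q hpq
  unfold chi
  by_cases hq : (q.2 : ℕ) < (a.1 q.1 : ℕ)
  · have hp : (p.2 : ℕ) < (a.1 p.1 : ℕ) := by
      have h1 : (p.2 : ℕ) ≤ q.2 := hpq.2
      have h2 : (a.1 q.1 : ℕ) ≤ a.1 p.1 := a.2 hpq.1
      omega
    rw [if_pos hq, if_pos hp]
  · rw [if_neg hq]
    split_ifs <;> norm_num

/-! ### Descent and the perturbations `a⁺, a⁻, a⋆` -/

/-- Updating an antitone sequence at `j` with a value squeezed between its neighbours keeps it antitone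
(plumbing). [folklore] -/
private theorem antitone_update {a : Fin m → Fin (m + 1)} (ha : Antitone a) (j : Fin m) (v : Fin (m + 1))
    (hlo : ∀ p, p < j → v ≤ a p) (hhi : ∀ q, j < q → a q ≤ v) : Antitone (update a j v) := by
  intro p q hpq
  rcases eq_or_ne q j with rfl | hq
  · rw [update_self]
    rcases eq_or_ne p q with rfl | hp
    · rw [update_self]
    · rw [update_of_ne hp]
      exact hlo p (lt_of_le_of_ne hpq hp)
  · rw [update_of_ne hq]
    rcases eq_or_ne p j with rfl | hp
    · rw [update_self]
      exact hhi q (lt_of_le_of_ne hpq (Ne.symm hq))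
    · rw [update_of_ne hp]
      exact ha hpq

/-- `a⁺ = a^{+,i}`: `a⁺_{i+1} = a_i` (here `j = i + 1`). [cite: LiebSahi2021, §2.1 (definition of a⁺)] -/
def plus (a : DSeq m) (i j : Fin m) (hij : (j : ℕ) = i + 1) : DSeq m :=
  ⟨update a.1 j (a.1 i),
    antitone_update a.2 j (a.1 i)
      (fun p hp => a.2 (Fin.le_iff_val_le_val.2 (by have : (p : ℕ) < j := hp; omega) : p ≤ i))
      (fun q hq => a.2 (Fin.le_iff_val_le_val.2 (by have : (j : ℕ) < q := hq; omega) : i ≤ q))⟩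

/-- `a⁻ = a^{−,i}`: `a⁻_i = a_{i+1}`. [cite: LiebSahi2021, §2.1 (definition of a⁻)] -/
def minus (a : DSeq m) (i j : Fin m) (hij : (j : ℕ) = i + 1) : DSeq m :=
  ⟨update a.1 i (a.1 j),
    antitone_update a.2 i (a.1 j)
      (fun p hp => (a.2 (Fin.le_iff_val_le_val.2 (by have : (p : ℕ) < i := hp; omega) : i ≤ j)).trans
        (a.2 (le_of_lt hp)))
      (fun q hq => a.2 (Fin.le_iff_val_le_val.2 (by have : (i : ℕ) < q := hq; omega)))⟩

/-- `a⋆ = a^{⋆,i}`: `a⋆_{i+1} = a_{i+1} + 1`, defined when `a` has descent at `i` (`a_{i+1} < a_i`).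
[cite: LiebSahi2021, §2.1 (definition of a⋆)] -/
def star (a : DSeq m) (i j : Fin m) (hij : (j : ℕ) = i + 1) (hd : a.1 j < a.1 i) : DSeq m :=
  ⟨update a.1 j ⟨(a.1 j : ℕ) + 1, by have := (a.1 i).2; have h2 : (a.1 j : ℕ) < a.1 i := hd; omega⟩,
    antitone_update a.2 j _
      (fun p hp => by
        have hpi : p ≤ i := Fin.le_iff_val_le_val.2 (by have : (p : ℕ) < j := hp; omega)
        have h1 := a.2 hpi
        have h2 : (a.1 j : ℕ) < a.1 i := hd
        exact Fin.le_iff_val_le_val.2 (by simp only []; have := Fin.le_iff_val_le_val.1 h1; omega))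
      (fun q hq => by
        have h1 := a.2 (le_of_lt hq)
        exact Fin.le_iff_val_le_val.2 (by have := Fin.le_iff_val_le_val.1 h1; simp only []; omega))⟩

/-- Values of `a⁺`. [cite: LiebSahi2021, §2.1] -/
theorem plus_apply (a : DSeq m) (i j : Fin m) (hij : (j : ℕ) = i + 1) (p : Fin m) :
    (plus a i j hij).1 p = if p = j then a.1 i else a.1 p := by
  show update a.1 j (a.1 i) p = _
  rw [update_apply]

/-- Values of `a⁻`. [cite: LiebSahi2021, §2.1] -/
theorem minus_apply (a : DSeq m) (i j : Fin m) (hij : (j : ℕ) = i + 1) (p : Fin m) :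
    (minus a i j hij).1 p = if p = i then a.1 j else a.1 p := by
  show update a.1 i (a.1 j) p = _
  rw [update_apply]

/-- Values of `a⋆` (as naturals). [cite: LiebSahi2021, §2.1] -/
theorem star_apply_val (a : DSeq m) (i j : Fin m) (hij : (j : ℕ) = i + 1) (hd : a.1 j < a.1 i)
    (p : Fin m) : ((star a i j hij hd).1 p : ℕ) = if p = j then (a.1 j : ℕ) + 1 else (a.1 p : ℕ) := by
  show ((update a.1 j _ p : Fin (m + 1)) : ℕ) = _
  rw [update_apply]
  split_ifs <;> rfl

/-! ### The column swap `τ` and the invariance of `E_n` -/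

/-- The reflection `τ` exchanging the columns `i` and `j` of the grid. [cite: LiebSahi2021, §2.1 (proof of Lemma 2.5: the columns i, i+1)] -/
def colSwap (i j : Fin m) : Grid m ≃ Grid m := Equiv.prodCongr (Equiv.swap i j) (Equiv.refl (Fin m))

/-- `τ (p, q) = (swap i j p, q)`. [cite: LiebSahi2021, §2.1] -/
theorem colSwap_apply (i j p q : Fin m) : colSwap i j (p, q) = (Equiv.swap i j p, q) := rfl

/-- **`E_n` under the uniform weight is invariant under every bijection of the grid** (the weight is
constant, so `e_* υ = υ`, and `E_n^{e_* υ}(f) = E_n^{υ}(f ∘ e)`); used for the column swap and for the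
reflection of the square. [cite: LiebSahi2021, §2 (before Thm. 2.1: the change of variables `x_i ↦ 1 − x_i`) and §2.1 (Lemma 2.5)] -/
theorem sahiE_comp_gridEquiv (e : Grid m ≃ Grid m) (n : ℕ) (f : Fin n → Grid m → ℝ) :
    sahiE (gridWeight m) n (fun k => f k ∘ e) = sahiE (gridWeight m) n f := by
  have h : pushWeight (gridWeight m) e = gridWeight m := by
    funext x
    rw [pushWeight_equiv]
    rfl
  rw [← sahiE_pushWeight, h]

/-- In particular `E_n` is invariant under the column swap `τ`. [cite: LiebSahi2021, §2.1 (Lemma 2.5 / Prop. 2.6)] -/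
theorem sahiE_comp_colSwap (i j : Fin m) (n : ℕ) (f : Fin n → Grid m → ℝ) :
    sahiE (gridWeight m) n (fun k => f k ∘ colSwap i j) = sahiE (gridWeight m) n f :=
  sahiE_comp_gridEquiv (colSwap i j) n f

/-- A sequence without descent at `i` gives a `τ`-invariant `χ_a`. [cite: LiebSahi2021, §2.1 (Lemma 2.5: "`b` does not [have descent at `i`]")] -/
theorem chi_comp_colSwap_of_eq (a : DSeq m) {i j : Fin m} (h : a.1 i = a.1 j) :
    chi a ∘ colSwap i j = chi a := by
  funext pq
  obtain ⟨p, q⟩ := pq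
  rw [Function.comp_apply, colSwap_apply]
  unfold chi
  dsimp only
  by_cases hpi : p = i
  · subst hpi
    simp only [Equiv.swap_apply_left, h]
  · by_cases hpj : p = j
    · subst hpj
      simp only [Equiv.swap_apply_right, h]
    · simp only [Equiv.swap_apply_of_ne_of_ne hpi hpj]

/-! ### The indicator identities behind Lemmas 2.5 and 2.7 -/

/-- The strip `h = χ_{a⁺} − χ_a`: the cells `(i+1, q)` with `a_{i+1} ≤ q < a_i`.
[cite: LiebSahi2021, §2.1 (Lemma 2.5)] -/
def strip (a : DSeq m) (i j : Fin m) : Grid m → ℝ :=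
  fun p => if p.1 = j ∧ (a.1 j : ℕ) ≤ p.2 ∧ (p.2 : ℕ) < a.1 i then 1 else 0

/-- `χ_{a⁺} = χ_a + h`. [cite: LiebSahi2021, §2.1 (Lemma 2.5)] -/
theorem chi_plus (a : DSeq m) (i j : Fin m) (hij : (j : ℕ) = i + 1) :
    chi (plus a i j hij) = chi a + strip a i j := by
  funext p
  obtain ⟨p, q⟩ := p
  simp only [chi, Pi.add_apply, strip, plus_apply]
  have hmono : (a.1 j : ℕ) ≤ a.1 i := a.2 (Fin.le_iff_val_le_val.2 (by omega))
  by_cases hp : p = j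
  · subst hp
    simp only [↓reduceIte, true_and]
    split_ifs <;> norm_num <;> omega
  · simp only [hp, ↓reduceIte, false_and, add_zero]

/-- `χ_{a⁻} = χ_a − h ∘ τ` (the strip reflected into column `i`). [cite: LiebSahi2021, §2.1 (Lemma 2.5)] -/
theorem chi_minus (a : DSeq m) (i j : Fin m) (hij : (j : ℕ) = i + 1) :
    chi (minus a i j hij) = chi a - strip a i j ∘ colSwap i j := by
  funext p
  obtain ⟨p, q⟩ := p
  have hne : i ≠ j := fun h => by have := congrArg Fin.val h; omega
  simp only [chi, Pi.sub_apply, Function.comp_apply, colSwap_apply, strip, minus_apply]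
  have hmono : (a.1 j : ℕ) ≤ a.1 i := a.2 (Fin.le_iff_val_le_val.2 (by omega))
  by_cases hp : p = i
  · subst hp
    simp only [↓reduceIte, Equiv.swap_apply_left, true_and]
    split_ifs <;> norm_num <;> omega
  · by_cases hpj : p = j
    · subst hpj
      simp only [hne.symm, ↓reduceIte, Equiv.swap_apply_right, hne, false_and, sub_zero]
    · simp only [hp, ↓reduceIte, Equiv.swap_apply_of_ne_of_ne hp hpj, hpj, false_and, sub_zero]

/-- The single cell `(i+1, a_{i+1})` added by `a⋆`. [cite: LiebSahi2021, §2.1 (Lemma 2.7) and §3.4 (proof of A(n) ⇒ B(n): `S = S_{c⋆} ∖ S_c`)] -/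
def starCell (a : DSeq m) (i j : Fin m) (hd : a.1 j < a.1 i) : Grid m :=
  (j, ⟨(a.1 j : ℕ), by have := (a.1 i).2; have h2 : (a.1 j : ℕ) < a.1 i := hd; omega⟩)

/-- `χ_{a⋆} = χ_a + 1_{cell}`. [cite: LiebSahi2021, §3.4 (proof of A(n) ⇒ B(n)); §2.1 (Lemma 2.7)] -/
theorem chi_star (a : DSeq m) (i j : Fin m) (hij : (j : ℕ) = i + 1) (hd : a.1 j < a.1 i) :
    chi (star a i j hij hd) = chi a + setInd {starCell a i j hd} := by
  funext p
  obtain ⟨p, q⟩ := p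
  simp only [chi, Pi.add_apply, setInd_apply, mem_singleton, starCell, star_apply_val, Prod.mk.injEq,
    Fin.ext_iff]
  by_cases hp : p = j
  · subst hp
    simp only [↓reduceIte, true_and]
    split_ifs <;> norm_num <;> omega
  · have hp' : ¬ ((p : ℕ) = j) := fun h => hp (Fin.ext h)
    simp only [↓reduceIte, hp', false_and, add_zero]

/-- **Lemma 2.7** in indicator form: if `b, a` have descent at `i` and `b_{i+1} ≤ a_{i+1}` then the added
cell of `a⋆` is outside `S_b`: `χ_b · 1_{cell} = 0` ("`a⋆ b = a b`").
[cite: LiebSahi2021, §2.1 (Lemma 2.7)] -/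
theorem chi_mul_starCell_eq_zero (a b : DSeq m) (i j : Fin m) (hd : a.1 j < a.1 i)
    (hb : b.1 j ≤ a.1 j) : chi b * setInd {starCell a i j hd} = 0 := by
  funext pq
  rw [Pi.mul_apply, Pi.zero_apply, setInd_apply]
  by_cases hcell : pq ∈ ({starCell a i j hd} : Finset (Grid m))
  · rw [if_pos hcell, mul_one, mem_singleton.1 hcell]
    unfold chi starCell
    dsimp only
    have hb' : (b.1 j : ℕ) ≤ a.1 j := Fin.le_iff_val_le_val.1 hb
    rw [if_neg (not_lt.2 hb')]
  · rw [if_neg hcell, mul_zero]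

/-! ### Proposition 3.10 (and 2.6): the averaging identity -/

/-- Slot families: replacing `a` by `a'` in slot `k` of `(χ_{a^1},…,χ_{a^n})` is the slot update of the
family of indicators (the families `E_n(a^1,…,a^{n−1},a^±)`, `E_n(a^1,…,b,c⋆)` of §3.4; plumbing).
[cite: LiebSahi2021, Prop. 3.10 and Thm. 3.12 (§3.4)] -/
theorem chi_comp_update {n : ℕ} (t : Fin n → DSeq m) (k : Fin n) (x : DSeq m) :
    (fun k' => chi (update t k x k')) = update (fun k' => chi (t k')) k (chi x) := by
  funext k'
  by_cases h : k' = k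
  · subst h
    simp only [update_self]
  · simp only [update_of_ne h]

/-- **Proposition 3.10** (Prop. 2.6 for `n = 3`): if `a = t k` has descent at `i` (`j = i+1`) but no
other slot has, then `E_n(…,a⁺,…) + E_n(…,a⁻,…) = 2E_n(…,a,…)` under the uniform weight.  Proof: by
multilinearity the two differences are `E_n(…,h,…)` and `−E_n(…,h∘τ,…)`; the column swap `τ` fixes every
other slot and the weight, so these agree. [cite: LiebSahi2021, Prop. 3.10 (§3.4) and Prop. 2.6 (§2.1)] -/
theorem sahiE_plus_add_minus {n : ℕ} (t : Fin n → DSeq m) (k : Fin n) (i j : Fin m)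
    (hij : (j : ℕ) = i + 1) (hothers : ∀ k', k' ≠ k → (t k').1 i = (t k').1 j) :
    sahiE (gridWeight m) n (fun k' => chi (update t k (plus (t k) i j hij) k')) +
        sahiE (gridWeight m) n (fun k' => chi (update t k (minus (t k) i j hij) k')) =
      2 * sahiE (gridWeight m) n (fun k' => chi (t k')) := by
  set F : Fin n → Grid m → ℝ := fun k' => chi (t k') with hF
  set h : Grid m → ℝ := strip (t k) i j with hh
  rw [chi_comp_update, chi_comp_update, chi_plus, chi_minus]
  -- linearity in slot `k`
  have h1 : sahiE (gridWeight m) n (update F k (chi (t k) + h)) =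
      sahiE (gridWeight m) n F + sahiE (gridWeight m) n (update F k h) := by
    rw [sahiE_update_add, show update F k (chi (t k)) = F from update_eq_self k F]
  have h2 : sahiE (gridWeight m) n (update F k (chi (t k) - h ∘ colSwap i j)) =
      sahiE (gridWeight m) n F - sahiE (gridWeight m) n (update F k (h ∘ colSwap i j)) := by
    have key := sahiE_update_lin (gridWeight m) n F k 1 (-1) (chi (t k)) (h ∘ colSwap i j)
    rw [one_smul, neg_one_smul, ← sub_eq_add_neg, one_mul, neg_one_mul, ← sub_eq_add_neg,
      show update F k (chi (t k)) = F from update_eq_self k F] at key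
    exact key
  -- the reflection exchanges the two differences
  have h3 : sahiE (gridWeight m) n (update F k (h ∘ colSwap i j)) =
      sahiE (gridWeight m) n (update F k h) := by
    rw [← sahiE_comp_colSwap i j n (update F k h)]
    congr 1
    funext k'
    by_cases hk : k' = k
    · subst hk
      simp only [update_self]
    · simp only [update_of_ne hk]
      exact (chi_comp_colSwap_of_eq (t k') (hothers k' hk)).symm
  rw [h1, h2, h3]
  ring

end UnitSquare

end Literature.Combinatorics.Sahi2008
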